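import Literature.Claims.NS.Magsanop2026
import Literature.Barriers.NavierStokesRegularity.ScalingAudit
import Summits.NavierStokesRegularity.NavierStokesRegularity.Theorems.SoloRefuteRamm2024
import Mathlib.MeasureTheory.Measure.Haar.NormedSpace
import HarnessLib

/-!
# C145 `Magsanop2026` — records-grade kernel object: `¬ Step_GN` by the SCALING AUDIT

`Literature.Claims.NS.Magsanop2026.Step_GN` types p.3 l.71–75 «By Gagliardo–Nirenberg,
‖ω‖_{L∞} ≤ C‖ω‖^{1/2}_{L²}‖Δω‖^{1/2}_{L²}» as ONE absolute constant `C` with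
`‖w x‖ ≤ C · (∫‖w‖²)^{1/4} · (∫‖Δw‖²)^{1/4}` for every smooth compactly supported field `w` on `ℝ³`
and every point `x`. The exponent pair `(½, ½)` is the two-dimensional one: under the spatial
dilations `w ↦ w(λ·)` (`λ > 0`) the value at the origin is FIXED (degree `0`), `∫‖w(λ·)‖² = λ⁻³ ∫‖w‖²`
(degree `-3`) and `∫‖Δ(w(λ·))‖² = λ · ∫‖Δw‖²` (degree `+1`), so the right-hand side has degree
`¼·(-3) + ¼·1 = -½ ≠ 0` and the catalogued barrier
`Literature.Barriers.NavierStokesRegularity.ScalingAudit.not_exists_forall_le_rpow_mul_rpow_of_exponent_ne`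
[cite: Tao2007WhyNSHard, supercriticality paragraph] refutes the display on the dilation-invariant class
of test fields, witnessed by a translate of the landed compactly supported smooth field
`Theorems.Ramm2024.testDatum` that does not vanish at the origin.

Main results (namespace `Summit.NavierStokesRegularity.NavierStokesRegularity.Theorems.Magsanop2026`,
the C145 kit's; all names new):
* `laplacian_comp_smul` — `Δ (w(c·)) x = c² • (Δ w)(c x)` for `C²` fields;
* `lapSq_comp_smul` — `lapSq (w(c·)) = c · lapSq w` for `c > 0`;
* `integral_norm_sq_comp_smul` — `∫‖w(c y)‖² dy = c⁻³ ∫‖w‖²` for `c > 0`;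
* `not_Step_GN : ¬ Literature.Claims.NS.Magsanop2026.Step_GN`.

WHAT THIS IS NOT: not a claim about NS regularity or blow-up; not a claim about any author beyond the
typed locator [cite: Magsanop2026, §3 p.3 l.71–75]. `Step_GN` is binder `hGN` of the PROVED compositions
`claim_of_steps` / `claim_of_printed_steps` of the skeleton, downstream of the head; this object is
records-grade (no head, no class change).
-/

set_option linter.dupNamespace false

open MeasureTheory Set Function
open scoped ContDiff Laplacian

namespace Summit.NavierStokesRegularity.NavierStokesRegularity.Theorems.Magsanop2026

open Literature.Analysis.FluidPDE Literature.Claims.NS.Magsanop2026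
open Summit.NavierStokesRegularity.NavierStokesRegularity.Theorems.Ramm2024 (testDatum contDiff_testDatum
  hasCompactSupport_testDatum testDatum_ne_zero)

/-! ## The Laplacian under spatial dilation -/

/-- **Chain rule for the Laplacian under dilation**: for a `C²` field `w` on `ℝ³` and a real `c`,
`Δ (y ↦ w (c • y)) x = c² • (Δ w) (c • x)` (Mathlib: `Δ f x = ∑ᵢ D²f(x)[eᵢ,eᵢ]` over an orthonormal
basis, `ContinuousLinearMap.iteratedFDeriv_comp_right` for the linear map `c • id`, and bilinearity).
[folklore] -/
theorem laplacian_comp_smul {w : E3 → E3} (hw : ContDiff ℝ 2 w) (c : ℝ) (x : E3) :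
    (Δ (fun y => w (c • y))) x = c ^ 2 • (Δ w) (c • x) := by
  set g : E3 →L[ℝ] E3 := c • ContinuousLinearMap.id ℝ E3 with hg_def
  have hg : ∀ v : E3, g v = c • v := fun v => by simp [hg_def]
  have hfg : (fun y => w (c • y)) = w ∘ g := by
    funext y
    simp [hg]
  rw [InnerProductSpace.laplacian_eq_iteratedFDeriv_orthonormalBasis (fun y => w (c • y))
      (stdOrthonormalBasis ℝ E3),
    InnerProductSpace.laplacian_eq_iteratedFDeriv_orthonormalBasis w (stdOrthonormalBasis ℝ E3)]
  simp only [Finset.smul_sum]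
  refine Finset.sum_congr rfl fun i _ => ?_
  rw [hfg, ContinuousLinearMap.iteratedFDeriv_comp_right g hw x (i := 2) le_rfl,
    ContinuousMultilinearMap.compContinuousLinearMap_apply]
  have h2 : (fun j : Fin 2 => g (![(stdOrthonormalBasis ℝ E3) i, (stdOrthonormalBasis ℝ E3) i] j)) =
      fun j : Fin 2 => (fun _ : Fin 2 => c) j •
        ![(stdOrthonormalBasis ℝ E3) i, (stdOrthonormalBasis ℝ E3) i] j := by
    funext j
    rw [hg]
  rw [h2, ContinuousMultilinearMap.map_smul_univ, hg]
  simp [pow_two]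

/-- **`‖Δ·‖²_{L²}` under dilation**: `lapSq (y ↦ w (c • y)) = c · lapSq w` for `c > 0` and `C²` fields
(`‖Δ(w(c·))(x)‖² = c⁴‖(Δw)(cx)‖²` by `laplacian_comp_smul`, then the change of variables
`∫ f(c x) dx = c⁻³ ∫ f`, Mathlib `Measure.integral_comp_smul_of_nonneg`, `dim ℝ³ = 3`). [folklore] -/
theorem lapSq_comp_smul {w : E3 → E3} (hw : ContDiff ℝ 2 w) {c : ℝ} (hc : 0 < c) :
    lapSq (fun y => w (c • y)) = c * lapSq w := by
  unfold lapSq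
  set f : E3 → ℝ := fun z => ‖(Δ w) z‖ ^ 2 with hf
  have h1 : (fun x => ‖(Δ (fun y => w (c • y))) x‖ ^ 2) = fun x => c ^ 4 * f (c • x) := by
    funext x
    rw [laplacian_comp_smul hw c x, norm_smul, mul_pow, Real.norm_eq_abs, abs_of_nonneg (sq_nonneg c)]
    simp only [hf]
    ring
  rw [h1, integral_const_mul, Measure.integral_comp_smul_of_nonneg volume f c (hR := hc.le),
    finrank_euclideanSpace_fin, smul_eq_mul]
  field_simp

/-- **`‖·‖²_{L²}` under dilation**: `∫‖w (c • y)‖² dy = (c³)⁻¹ · ∫‖w‖²` for `c > 0` (Mathlib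
`Measure.integral_comp_smul_of_nonneg`, `dim ℝ³ = 3`). [folklore] -/
theorem integral_norm_sq_comp_smul (w : E3 → E3) {c : ℝ} (hc : 0 < c) :
    ∫ y, ‖w (c • y)‖ ^ 2 = (c ^ 3)⁻¹ * ∫ y, ‖w y‖ ^ 2 := by
  rw [Measure.integral_comp_smul_of_nonneg volume (fun z => ‖w z‖ ^ 2) c (hR := hc.le),
    finrank_euclideanSpace_fin, smul_eq_mul]

/-- Test fields are closed under spatial dilation by a nonzero factor. [folklore] -/
theorem isTestField_comp_smul {w : E3 → E3} (hw : IsTestField w) {c : ℝ} (hc : c ≠ 0) :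
    IsTestField fun y => w (c • y) :=
  ⟨hw.1.comp (contDiff_id.const_smul c), hw.2.comp_smul hc⟩

/-- A translate of the landed compactly supported smooth field `Ramm2024.testDatum` is a test field
that does not vanish at the origin. [folklore] -/
theorem exists_isTestField_apply_zero_ne_zero : ∃ w : E3 → E3, IsTestField w ∧ w 0 ≠ 0 := by
  obtain ⟨x₀, hx₀⟩ := Function.ne_iff.mp testDatum_ne_zero
  replace hx₀ : testDatum x₀ ≠ 0 := by simpa using hx₀
  refine ⟨fun y => testDatum (y + x₀), ⟨?_, ?_⟩, by simpa using hx₀⟩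
  · exact contDiff_testDatum.comp (contDiff_id.add contDiff_const)
  · have h := hasCompactSupport_testDatum.comp_homeomorph (Homeomorph.addRight x₀)
    rwa [Homeomorph.coe_addRight] at h

/-! ## The refutation -/

/-- **`Step_GN` is false as typed** (p.3 l.71–75 «‖ω‖_{L∞} ≤ C‖ω‖^{1/2}_{L²}‖Δω‖^{1/2}_{L²}» with ONE
absolute `C` on `ℝ³`): specialise the display at the origin and run the catalogued SCALING AUDIT
`ScalingAudit.not_exists_forall_le_rpow_mul_rpow_of_exponent_ne` on the dilation family
`δ λ w = w(λ·)` acting on the class of test fields — degrees `F = ‖w 0‖ ↦ 0`, `∫‖w‖² ↦ -3`,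
`lapSq ↦ +1`, exponents `a = b = ¼`, and `0 ≠ ¼·(-3) + ¼·1 = -½`; the witness with `F > 0` is
`exists_isTestField_apply_zero_ne_zero`. (The three-dimensional Agmon pair is `(¼, ¾)`.)
[cite: Magsanop2026, §3 p.3 l.71–75] [cite: Tao2007WhyNSHard, supercriticality paragraph] -/
theorem not_Step_GN : ¬ Literature.Claims.NS.Magsanop2026.Step_GN := by
  rintro ⟨C, -, hC⟩
  obtain ⟨w₀, hw₀, hw₀0⟩ := exists_isTestField_apply_zero_ne_zero
  have key := Literature.Barriers.NavierStokesRegularity.ScalingAudit.not_exists_forall_le_rpow_mul_rpow_of_exponent_ne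
    (X := E3 → E3) (δ := fun l w => fun y => w (l • y)) (S := {w | IsTestField w})
    (F := fun w => ‖w 0‖) (G₁ := fun w => ∫ y, ‖w y‖ ^ 2) (G₂ := lapSq)
    (s := 0) (r₁ := -3) (r₂ := 1) (a := 1 / 4) (b := 1 / 4) (u₀ := w₀)
    (fun l hl u hu => isTestField_comp_smul hu hl.ne')
    (fun l hl u _ => by simp [Real.rpow_zero])
    (fun l hl u _ => by
      rw [integral_norm_sq_comp_smul u hl, Real.rpow_neg hl.le, Real.rpow_ofNat])
    (fun l hl u hu => by
      rw [lapSq_comp_smul (hu.1.of_le (by norm_cast)) hl, Real.rpow_one])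
    (fun u _ => integral_nonneg fun y => by positivity)
    (fun u _ => integral_nonneg fun y => by positivity)
    (by norm_num) hw₀ (norm_pos_iff.mpr hw₀0)
  exact key ⟨C, fun u hu => by simpa [mul_assoc] using hC u hu 0⟩

end Summit.NavierStokesRegularity.NavierStokesRegularity.Theorems.Magsanop2026
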